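import Mathlib
import Literature.Analysis.FunctionSpaces.BochnerProofs
import HarnessLib

/-!
# `EmbeddedDrudeMourre.MourreDissolution`, stub `stub_cosineBochner` — the cosine Bochner theorem

Item `stmt-AtomisticToContinuum-12594` (crux `MourreDissolution` of route `EmbeddedDrudeMourre`,
sub-problem `FouriersLaw`), line `separable-vertex-faddeev-pair-sector`, stub S2 (pure analysis).

Statement: an even continuous `C : ℝ → ℝ` which is positive semidefinite over *real* coefficient
vectors, `0 ≤ ∑ᵢⱼ cᵢ cⱼ C (τⱼ - τᵢ)`, is the cosine transform `C t = ∫ cos (ω t) dσ(ω)` of a finite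
(positive Borel) measure `σ` on `ℝ` — the spectral measure of the current autocorrelation.

Proof (Bochner 1933, Satz 22, in the form proved in the tree as
`Literature.Analysis.FunctionSpaces.IsPositiveDefinite.exists_charFun_eq_holds`):
1. `isPositiveDefinite_ofReal` — evenness upgrades real positive semidefiniteness to complex
   positive definiteness of `t ↦ (C t : ℂ)`: writing `c = a + i b`, the Hermitian double sum is
   `∑ (aᵢaⱼ + bᵢbⱼ) C(τⱼ-τᵢ) + i ∑ (aᵢbⱼ - bᵢaⱼ) C(τⱼ-τᵢ)`, whose imaginary part vanishes because
   `C(τⱼ-τᵢ)` is symmetric and `aᵢbⱼ - bᵢaⱼ` antisymmetric in `(i, j)`.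
2. `abs_le_apply_zero` — `|C t| ≤ C 0` (the `2 × 2` forms with coefficients `(1, ±1)`), so
   `C 0 = 0` forces `C = 0` and `σ = 0` works.
3. Otherwise `C / C 0` is a continuous positive-definite function equal to `1` at `0`, hence
   (Bochner) the characteristic function of a probability measure `μ`; taking real parts in
   `charFun μ t = ∫ exp (i t x) dμ(x)` gives `C t / C 0 = ∫ cos (x t) dμ(x)`, and
   `σ := C 0 • μ`.
-/

noncomputable section

open MeasureTheory Complex
open scoped ComplexConjugate NNReal ENNReal

namespace Summit.AtomisticToContinuum.FouriersLaw.Theorems.MourreDissolution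

/-! ### 1. Real positive semidefinite + even ⇒ complex positive definite -/

/-- An even real function `D : ℝ → ℝ` which is positive semidefinite over real coefficient
vectors is positive definite as a complex-valued function in the sense of
`Literature.Analysis.FunctionSpaces.IsPositiveDefinite` (complex coefficients): with
`c = a + i b` the Hermitian form splits as the sum of the real forms of `a` and of `b` plus
`i` times an antisymmetric sum, which vanishes by evenness. [folklore] -/
theorem isPositiveDefinite_ofReal {D : ℝ → ℝ} (heven : ∀ t : ℝ, D (-t) = D t)
    (hpsd : ∀ (n : ℕ) (c τ : Fin n → ℝ), 0 ≤ ∑ i, ∑ j, c i * c j * D (τ j - τ i)) :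
    Literature.Analysis.FunctionSpaces.IsPositiveDefinite (fun t : ℝ => ((D t : ℝ) : ℂ)) := by
  intro n x c
  have hre : (∑ i, ∑ j, conj (c i) * c j * ((D (x j - x i) : ℝ) : ℂ)).re =
      ∑ i, ∑ j, (c i).re * (c j).re * D (x j - x i) +
        ∑ i, ∑ j, (c i).im * (c j).im * D (x j - x i) := by
    simp only [Complex.re_sum, Complex.mul_re, Complex.mul_im, Complex.conj_re, Complex.conj_im,
      Complex.ofReal_re, Complex.ofReal_im, ← Finset.sum_add_distrib]
    refine Finset.sum_congr rfl fun i _ => Finset.sum_congr rfl fun j _ => ?_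
    ring
  have him : (∑ i, ∑ j, conj (c i) * c j * ((D (x j - x i) : ℝ) : ℂ)).im =
      ∑ i, ∑ j, (c i).re * (c j).im * D (x j - x i) -
        ∑ i, ∑ j, (c i).im * (c j).re * D (x j - x i) := by
    simp only [Complex.im_sum, Complex.mul_re, Complex.mul_im, Complex.conj_re, Complex.conj_im,
      Complex.ofReal_re, Complex.ofReal_im, ← Finset.sum_sub_distrib]
    refine Finset.sum_congr rfl fun i _ => Finset.sum_congr rfl fun j _ => ?_
    ring
  have hswap : ∑ i, ∑ j, (c i).im * (c j).re * D (x j - x i) =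
      ∑ i, ∑ j, (c i).re * (c j).im * D (x j - x i) := by
    rw [Finset.sum_comm]
    refine Finset.sum_congr rfl fun i _ => Finset.sum_congr rfl fun j _ => ?_
    rw [show x i - x j = -(x j - x i) by ring, heven]
    ring
  refine ⟨?_, ?_⟩
  · rw [hre]
    exact add_nonneg (hpsd n (fun i => (c i).re) x) (hpsd n (fun i => (c i).im) x)
  · rw [him, hswap, sub_self]

/-! ### 2. The bound `|C t| ≤ C 0` -/

/-- A real function which is positive semidefinite over real coefficient vectors and even is
bounded by its value at `0`: `|C t| ≤ C 0` (the `2 × 2` forms at the points `(0, t)` with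
coefficients `(1, 1)` and `(1, -1)`). [folklore] -/
theorem abs_le_apply_zero {C : ℝ → ℝ} (heven : ∀ t : ℝ, C (-t) = C t)
    (hpsd : ∀ (n : ℕ) (c τ : Fin n → ℝ), 0 ≤ ∑ i, ∑ j, c i * c j * C (τ j - τ i)) (t : ℝ) :
    |C t| ≤ C 0 := by
  have h1 := hpsd 2 ![1, 1] ![0, t]
  have h2 := hpsd 2 ![1, -1] ![0, t]
  simp only [Fin.sum_univ_two, Matrix.cons_val_zero, Matrix.cons_val_one, sub_zero, sub_self,
    zero_sub, heven, one_mul, mul_one, neg_mul, mul_neg, neg_neg] at h1 h2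
  rw [abs_le]
  constructor <;> linarith

/-! ### 3. The cosine Bochner theorem -/

/-- **Stub S2 — cosine Bochner theorem.** An even continuous real function `C` which is positive
semidefinite over real coefficient vectors is the cosine transform of a finite measure:
`C t = ∫ cos (ω t) dσ(ω)`. If `C 0 = 0` then `C = 0` (`abs_le_apply_zero`) and `σ = 0`;
otherwise `C / C 0` is continuous, complex positive definite (`isPositiveDefinite_ofReal`) and
`1` at `0`, so by Bochner's theorem
(`Literature.Analysis.FunctionSpaces.IsPositiveDefinite.exists_charFun_eq_holds`, Bochner 1933
Satz 22) it is `charFun μ` for a probability measure `μ`; the real part of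
`charFun μ t = ∫ exp (i t x) dμ(x)` is `∫ cos (x t) dμ(x)`, and `σ := C 0 • μ`. [folklore] -/
theorem stub_cosineBochner :
    ∀ C : ℝ → ℝ, Continuous C → (∀ t : ℝ, C (-t) = C t) →
      (∀ (n : ℕ) (c τ : Fin n → ℝ), 0 ≤ ∑ i, ∑ j, c i * c j * C (τ j - τ i)) →
      ∃ σ : MeasureTheory.Measure ℝ, MeasureTheory.IsFiniteMeasure σ ∧
        ∀ t : ℝ, C t = MeasureTheory.integral σ (fun ω : ℝ => Real.cos (ω * t)) := by
  intro C hC heven hpsd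
  have h0 : 0 ≤ C 0 := by
    have := hpsd 1 (fun _ => 1) (fun _ => 0)
    simpa using this
  have hbound : ∀ t, |C t| ≤ C 0 := abs_le_apply_zero heven hpsd
  rcases h0.eq_or_lt with h00 | h0pos
  · -- `C 0 = 0`, hence `C = 0` and the zero measure works.
    refine ⟨0, inferInstance, fun t => ?_⟩
    rw [MeasureTheory.integral_zero_measure]
    have ht := hbound t
    rw [← h00] at ht
    exact abs_eq_zero.1 (le_antisymm ht (abs_nonneg _))
  · -- `C 0 > 0`: normalise and apply Bochner's theorem.
    set D : ℝ → ℝ := fun t => C t / C 0 with hD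
    have hDeven : ∀ t, D (-t) = D t := fun t => by simp [hD, heven]
    have hDpsd : ∀ (n : ℕ) (c τ : Fin n → ℝ), 0 ≤ ∑ i, ∑ j, c i * c j * D (τ j - τ i) := by
      intro n c τ
      have hsum : ∑ i, ∑ j, c i * c j * D (τ j - τ i) =
          (∑ i, ∑ j, c i * c j * C (τ j - τ i)) / C 0 := by
        rw [Finset.sum_div]
        refine Finset.sum_congr rfl fun i _ => ?_
        rw [Finset.sum_div]
        refine Finset.sum_congr rfl fun j _ => ?_
        rw [hD, mul_div_assoc]
      rw [hsum]
      exact div_nonneg (hpsd n c τ) h0pos.le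
    have hpd := isPositiveDefinite_ofReal hDeven hDpsd
    have hcont : Continuous (fun t : ℝ => ((D t : ℝ) : ℂ)) :=
      Complex.continuous_ofReal.comp (hC.div_const _)
    have hD0 : (fun t : ℝ => ((D t : ℝ) : ℂ)) 0 = 1 := by
      simp [hD, div_self h0pos.ne']
    obtain ⟨μ, hμ, hμC⟩ :=
      Literature.Analysis.FunctionSpaces.IsPositiveDefinite.exists_charFun_eq_holds (V := ℝ)
        hpd hcont hD0
    refine ⟨(C 0).toNNReal • μ, inferInstance, fun t => ?_⟩
    rw [MeasureTheory.integral_smul_nnreal_measure]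
    have hint : Integrable (fun x : ℝ => Complex.exp (t * x * I)) μ := by
      refine Integrable.of_bound (by fun_prop) 1 (Filter.Eventually.of_forall fun x => ?_)
      have hx : ‖Complex.exp (t * x * I)‖ = 1 := by
        rw [← Complex.ofReal_mul, Complex.norm_exp_ofReal_mul_I]
      exact hx.le
    have hre : D t = ∫ ω, Real.cos (ω * t) ∂μ := by
      have h1 : charFun μ t = ((D t : ℝ) : ℂ) := by rw [hμC]
      rw [charFun_apply_real] at h1
      have h2 : D t = (∫ x : ℝ, Complex.exp (t * x * I) ∂μ).re := by
        rw [h1, Complex.ofReal_re]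
      rw [h2, ← RCLike.re_to_complex, ← integral_re hint]
      refine integral_congr_ae (Filter.Eventually.of_forall fun x => ?_)
      simp only [RCLike.re_to_complex]
      rw [← Complex.ofReal_mul, Complex.exp_ofReal_mul_I_re, mul_comm]
    rw [← hre, NNReal.smul_def, smul_eq_mul, Real.coe_toNNReal _ h0pos.le, hD]
    field_simp

end Summit.AtomisticToContinuum.FouriersLaw.Theorems.MourreDissolution

end
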